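import Summits.ResolutionOfSingularities.ResolutionOfSingularities.Theorems.EquisingularLiftEquisingularLiftNatLargeCharFactorDoor
import Summits.ResolutionOfSingularities.ResolutionOfSingularities.Theorems.EquisingularLiftEquisingularLiftNatLargeCharFactorModel
import Summits.ResolutionOfSingularities.ResolutionOfSingularities.Theorems.EquisingularLiftEquisingularLiftNatLargeCharSmoothBaseAway
import Summits.ResolutionOfSingularities.ResolutionOfSingularities.Theorems.EquisingularLiftEquisingularLiftNatLargeCharPointLift
import Summits.ResolutionOfSingularities.ResolutionOfSingularities.Theorems.EquisingularLiftEquisingularLiftNatNoseDescSharpRung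
import Mathlib.RingTheory.Smooth.Basic
import Mathlib.Algebra.CharP.Quotient
import HarnessLib

/-!
# EL♮(3) / EL♮(n), RUNG LC «large characteristic» — THE RUNG: `hspread` FUNDED and ★★★ `elnat_largeChar` — for every `n, d` there is `M(n, d)` such that
# for every prime `p > M`, every algebraically closed `k` of characteristic `p` and every INTEGRAL `H` embedded in `ℙⁿ_k` as the zero locus of a NON-ZERO
# degree-`d` form, the conclusion `ELNatConclusionO k n H ι` of EL♮(n) holds

leafhand-res-equisingularlift-4 g0 (prover, 2026-08-31; one-generation line-first hand on stmt-ResolutionOfSingularities-20148 / -20038 / -15660, cell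
`pub/decomp-res`).  Crux `EquisingularLiftNatThree` (`stmt-…-20148`; the rung is uniform in `n`, so also `stmt-…-20038`), line W4.5(b), RUNG LC (idea-2 g32
`Cruxes/EquisingularLiftNatThree/LARGE-CHAR-RUNG-idea2.md` v1.6; desk R93 «the chain's one ATTACKABLE leaf»).  This file discharges the LAST unfunded weight
`hspread` of ✓ `LargeChar.elnatLargeChar_of_spread` (…NatNoseDescSharpRung; roof ✓p733277, engine ✓p793810) and states the rung, DEF-FREE:

* `descDoorSharp_of_descDoorAt_int` — the N := 1 glue (idea-2 (c6), typed by crit-2 g15): a point-wise certificate `DescDoorAt B k θ n H ι` over a FORMALLY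
  SMOOTH `ℤ`-algebra `B` is a `DescDoorSharp k n H ι` certificate (`ℤ[1/1] → B` by `IsLocalization.Away.lift`, Mathlib `FormallySmooth.localization_base`);
* `not_mem_asHomogeneousIdeal_of_fin_one` — `ℙ⁰`: a non-zero form in one variable lies in no relevant homogeneous prime (the `n = 0` case is vacuous);
* `exists_eq_of_isIrreducible_eq_iUnion` — an irreducible set equal to a finite union of closed sets is one of them;
* ★★ `spread_holds` — `hspread` at the honest cut «`H` integral ∧ `F ≠ 0` ∧ `range ι = V₊(F)`»: around every characteristic-zero point `𝔮` of `Spec ℤ[c]`,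
  with `A := ℤ[c]/𝔮`, `K := Frac A`: factor the generic equation (✓ `exists_factorModel`), take the doors of all prime factors (✓ `exists_forall_descDoorAt_of_primeForm`),
  shrink to the smooth `ℤ`-algebra `B = A[1/a][1/a₀]` inverting everything (✓ `exists_smooth_away_away`), name the witness `f ∉ 𝔮` (✓ `exists_witness_factor_through_away_away`);
  at a point `θ` with `θ f ≠ 0` the integral `range ι = V₊(F_θ) = ⋃ᵢ V₊(Pᵢ,θ)` IS one `V₊(Pᵢ₀,θ)`, door `i₀` gives `DescDoorAt`, the glue gives `DescDoorSharp`;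
* ★★★ `elnat_largeChar` — the RUNG, = ✓ `elnatLargeChar_of_spread` at `spread_holds`.

HONEST READING (crit-3 g14, verbatim in substance): `M = M(n, d)` depends on the degree — this is a RUNG «EL♮(n)'s conclusion for degree-`d` integral
hypersurfaces in characteristic `> M(n, d)`», NOT EL♮(3) (all degrees at a fixed `p`), NOT a route to `closes`, and it closes none of the registered stubs
(`stub_elnat_three_isolated_nonNDLeaves9`, `…NoseLiftTowerZeroPrimeSigmaPGBTriplePrimeDesc`, `stub_elnat_ge_four_reachExit` quantify over ALL `p`).  `M` is
ineffective (Noetherian induction ✓ `exists_bound_forall_prime_of_generic`).  EL♮(3) NOT proved; EL♮ NOT proved; resolution of singularities in positive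
characteristic NOT proved; nothing of [Hironaka2017] (a candidate under adjudication) is asserted or used.  [OURS · composition of ✓ tree theorems · standard axioms ·
DEF-FREE · ZERO named hypotheses · `--supports stmt-ResolutionOfSingularities-20148 --as helper`, counted 0 · AI-written, weaker than expert review.]
[cite: Grothendieck1966, EGA IV₃ §8–§9] [cite: Kollar2007, Thm. 3.69] (method; index only)
-/

set_option linter.dupNamespace false -- mandated namespace `Summit.<Summit>.<Problem>` of this single-conjunct summit

noncomputable section

open CategoryTheory CategoryTheory.Limits AlgebraicGeometry TopologicalSpace Topology
open MvPolynomial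
open Literature.AlgebraicGeometry.Resolution
open Literature.AlgebraicGeometry.Motives
open AlgebraicGeometry.Scheme.IdealSheafData

namespace Summit.ResolutionOfSingularities.ResolutionOfSingularities.Cruxes.EquisingularLiftNat.Sections

/-! ## The N := 1 glue -/

/-- **The N := 1 glue** (idea-2 LARGE-CHAR-RUNG (c6); crit-2 g15's typing): a point-wise descent certificate over a FORMALLY SMOOTH `ℤ`-algebra `B` is a
`DescDoorSharp` certificate with `N := 1` — `B` is an algebra over `ℤ[1/1]` through `IsLocalization.Away.lift`, formally smooth over it by Mathlib's
`Algebra.FormallySmooth.localization_base`. [OURS · pure packaging] [folklore] -/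
theorem descDoorSharp_of_descDoorAt_int (k : Type) [Field k] (n : ℕ) (H : Scheme.{0})
    (ι : H ⟶ (Literature.AlgebraicGeometry.Motives.projectiveSpace n k).left)
    (B : Type) [CommRing B] [Algebra ℤ B] [Algebra.FormallySmooth ℤ B] (θ : B →+* k) (h : DescDoorAt B k θ n H ι) :
    DescDoorSharp k n H ι := by
  have h1 : IsUnit (algebraMap ℤ B (((1 : ℕ) : ℤ))) := by simp
  letI : Algebra (Localization.Away (((1 : ℕ) : ℤ))) B := (IsLocalization.Away.lift (((1 : ℕ) : ℤ)) h1).toAlgebra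
  haveI := IsScalarTower.of_algebraMap_eq' (R := ℤ) (S := Localization.Away (((1 : ℕ) : ℤ))) (A := B) (Subsingleton.elim _ _)
  haveI : Algebra.FormallySmooth (Localization.Away (((1 : ℕ) : ℤ))) B :=
    Algebra.FormallySmooth.localization_base (Submonoid.powers (((1 : ℕ) : ℤ)))
  exact ⟨1, by simp, B, inferInstance, inferInstance, inferInstance, θ, h⟩

namespace LargeChar

/-! ## Two small lemmas -/

/-- **`ℙ⁰` is the vacuous case**: a non-zero form in ONE variable is `c · x₀^d`, so it lies in no relevant homogeneous prime of `k[x₀]`. [folklore] -/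
theorem not_mem_asHomogeneousIdeal_of_fin_one (k : Type) [Field k] {d : ℕ} (F : MvPolynomial (Fin 1) k) (hF : F.IsHomogeneous d)
    (hF0 : F ≠ 0) :
    letI := MvPolynomial.gradedAlgebra (σ := Fin 1) (R := k)
    ∀ x : Proj (homogeneousSubmodule (Fin 1) k), F ∉ x.asHomogeneousIdeal := by
  classical
  letI := MvPolynomial.gradedAlgebra (σ := Fin 1) (R := k)
  intro x
  -- `F = C c * X 0 ^ d`
  set c : k := coeff (Finsupp.single (0 : Fin 1) d) F with hc
  have hsupp : ∀ m ∈ F.support, m = Finsupp.single (0 : Fin 1) d := by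
    intro m hm
    have hdeg : m.degree = d := by
      rw [Finsupp.degree_eq_weight_one]
      exact hF (mem_support_iff.mp hm)
    rw [Finsupp.degree_eq_sum, Fin.sum_univ_one] at hdeg
    rw [← hdeg]
    exact Finsupp.unique_single m
  have hFeq : F = C c * X (0 : Fin 1) ^ d := by
    rw [C_mul_X_pow_eq_monomial]
    ext m
    rw [coeff_monomial]
    split_ifs with h
    · rw [← h]
    · exact notMem_support_iff.mp fun hm => h (hsupp m hm).symm
  have hc0 : c ≠ 0 := by
    intro h0
    apply hF0
    rw [hFeq, h0, C_0, zero_mul]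
  intro hmem
  have hmem' : C c * X (0 : Fin 1) ^ d ∈ x.asHomogeneousIdeal.toIdeal := by rw [← hFeq]; exact hmem
  haveI := x.isPrime
  rcases (Ideal.IsPrime.mem_or_mem inferInstance hmem') with hC | hX
  · exact Ideal.IsPrime.ne_top inferInstance (Ideal.eq_top_of_isUnit_mem _ hC ((isUnit_iff_ne_zero.mpr hc0).map C))
  · have hX0 : (X (0 : Fin 1) : MvPolynomial (Fin 1) k) ∈ x.asHomogeneousIdeal.toIdeal :=
      Ideal.IsPrime.mem_of_pow_mem inferInstance d hX
    apply x.not_irrelevant_le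
    intro g hg
    have hle : g ∈ Ideal.span (Set.range (X : Fin 1 → MvPolynomial (Fin 1) k)) :=
      Summit.ResolutionOfSingularities.ResolutionOfSingularities.Cruxes.EquisingularLift.StrataSplit.irrelevant_le_span 0 k hg
    refine (Ideal.span_le.mpr ?_) hle
    rintro _ ⟨i, rfl⟩
    obtain rfl : i = 0 := Subsingleton.elim i 0
    exact hX0

/-- An irreducible set which is a finite union of closed sets is one of them. [folklore] -/
theorem exists_eq_of_isIrreducible_eq_iUnion {X : Type} [TopologicalSpace X] {N : ℕ} {S : Set X} (hS : IsIrreducible S)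
    (Z : Fin N → Set X) (hZ : ∀ i, IsClosed (Z i)) (h : S = ⋃ i, Z i) : ∃ i, S = Z i := by
  classical
  obtain ⟨z, hz, hSz⟩ := (isIrreducible_iff_sUnion_isClosed.mp hS) (Finset.univ.image Z)
    (fun z hz => by
      obtain ⟨i, -, rfl⟩ := Finset.mem_image.mp hz
      exact hZ i)
    (by
      rw [Finset.coe_image, Finset.coe_univ, Set.image_univ, Set.sUnion_range]
      exact h.le)
  obtain ⟨i, -, rfl⟩ := Finset.mem_image.mp hz
  exact ⟨i, le_antisymm hSz (h ▸ Set.subset_iUnion Z i)⟩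

/-! ## `hspread` funded -/

/-- ★★ **`hspread` FUNDED** at the honest cut «`H` integral ∧ `F ≠ 0` ∧ `range ι = V₊(F)`» — see the module docstring for the proof.
[cite: Grothendieck1966, EGA IV₃ §8–§9] [OURS · L1 W4.5b · RUNG LC (B3′)–(B5) composed; EL♮(3) NOT proved] -/
theorem spread_holds (n d : ℕ) :
    ∀ 𝔮 : Ideal (CoeffRingP n d), 𝔮.IsPrime → (∀ q : ℕ, q.Prime → (q : CoeffRingP n d) ∉ 𝔮) →
      ∃ f ∉ 𝔮, ∀ 𝔭 : Ideal (CoeffRingP n d), 𝔭.IsPrime → 𝔮 ≤ 𝔭 → f ∉ 𝔭 →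
        ∀ (k : Type) [Field k] [IsAlgClosed k] (θ : CoeffRingP n d →+* k), RingHom.ker θ = 𝔭 →
          ∀ (H : Scheme.{0}) (ι : H ⟶ (Literature.AlgebraicGeometry.Motives.projectiveSpace n k).left),
            (IsIntegral H ∧ univHyp n d θ ≠ 0 ∧
              letI := MvPolynomial.gradedAlgebra (σ := Fin (n + 1)) (R := k)
              Set.range ι = {x : Proj (homogeneousSubmodule (Fin (n + 1)) k) | univHyp n d θ ∈ x.asHomogeneousIdeal}) →
            DescDoorSharp k n H ι := by
  classical
  intro 𝔮 h𝔮 hchar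
  haveI := h𝔮
  have h1𝔮 : (1 : CoeffRingP n d) ∉ 𝔮 := fun h => h𝔮.ne_top ((Ideal.eq_top_iff_one _).mpr h)
  -- `A := ℤ[c]/𝔮`, a Noetherian domain of characteristic zero, of finite type over `ℤ`; `K := Frac A`
  haveI : IsDomain (CoeffRingP n d ⧸ 𝔮) := Ideal.Quotient.isDomain 𝔮
  haveI : CharZero (CoeffRingP n d ⧸ 𝔮) := by
    obtain ⟨p, hp⟩ := CharP.exists (CoeffRingP n d ⧸ 𝔮)
    rcases CharP.char_is_prime_or_zero (CoeffRingP n d ⧸ 𝔮) p with hpr | h0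
    · exfalso
      apply hchar p hpr
      rw [← Ideal.Quotient.eq_zero_iff_mem, map_natCast]
      exact CharP.cast_eq_zero _ p
    · subst h0
      exact CharP.charP_to_charZero _
  have hftA : Algebra.FiniteType ℤ (CoeffRingP n d ⧸ 𝔮) := inferInstance
  -- the `ℤ`-algebra structure is unique: transport `FiniteType` to whichever instance (B4) elaborates with
  have hft' : ∀ inst : Algebra ℤ (CoeffRingP n d ⧸ 𝔮), @Algebra.FiniteType ℤ (CoeffRingP n d ⧸ 𝔮) _ _ inst := fun inst => by
    convert hftA
    exact Subsingleton.elim _ _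
  haveI : CharZero (FractionRing (CoeffRingP n d ⧸ 𝔮)) :=
    charZero_of_injective_algebraMap (IsFractionRing.injective (CoeffRingP n d ⧸ 𝔮) (FractionRing (CoeffRingP n d ⧸ 𝔮)))
  -- the generic equation
  set FA : MvPolynomial (Fin (n + 1)) (CoeffRingP n d ⧸ 𝔮) := univHyp n d (Ideal.Quotient.mk 𝔮) with hFA
  have hFAhom : FA.IsHomogeneous d := isHomogeneous_univHyp n d _
  -- the equation at a point `θ` over `𝔮` is the specialisation of `FA`
  have hspec : ∀ (k : Type) [Field k] (θ : CoeffRingP n d →+* k) (ψ : CoeffRingP n d ⧸ 𝔮 →+* k),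
      ψ.comp (Ideal.Quotient.mk 𝔮) = θ → univHyp n d θ = MvPolynomial.map ψ FA := by
    intro k _ θ ψ hψ
    rw [hFA, map_univHyp, hψ]
  by_cases hFK : MvPolynomial.map (algebraMap (CoeffRingP n d ⧸ 𝔮) (FractionRing (CoeffRingP n d ⧸ 𝔮))) FA = 0
  · -- the generic equation vanishes: every member over `V(𝔮)` is the zero form — excluded by the cut
    have hFA0 : FA = 0 :=
      MvPolynomial.map_injective _ (IsFractionRing.injective (CoeffRingP n d ⧸ 𝔮) (FractionRing (CoeffRingP n d ⧸ 𝔮)))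
        (by rw [hFK, map_zero])
    refine ⟨1, h1𝔮, fun 𝔭 _ hle _ k _ _ θ hker H ι hcut => ?_⟩
    exfalso
    apply hcut.2.1
    have hθ𝔮 : ∀ x ∈ 𝔮, θ x = 0 := fun x hx => by rw [← RingHom.mem_ker, hker]; exact hle hx
    rw [hspec k θ (Ideal.Quotient.lift 𝔮 θ hθ𝔮) (RingHom.ext fun x => Ideal.Quotient.lift_mk 𝔮 θ hθ𝔮), hFA0, map_zero]
  by_cases hn : n = 0
  · -- `ℙ⁰`: the cut is contradictory (`V₊(F) = ∅` for a non-zero form in one variable, `H` is non-empty)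
    subst hn
    refine ⟨1, h1𝔮, fun 𝔭 _ _ _ k _ _ θ _ H ι hcut => ?_⟩
    exfalso
    obtain ⟨hH, hF0, hrange⟩ := hcut
    obtain ⟨h⟩ := (inferInstance : Nonempty H)
    have hx : ι.base h ∈ Set.range ι := ⟨h, rfl⟩
    rw [hrange] at hx
    exact not_mem_asHomogeneousIdeal_of_fin_one k (univHyp 0 d θ) (isHomogeneous_univHyp 0 d θ) hF0 _ hx
  have hn1 : 1 ≤ n := Nat.one_le_iff_ne_zero.mpr hn
  -- the factor models and the doors of the prime factors
  obtain ⟨N, P, e, c, hc, hPhom, hPprime, hfib⟩ :=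
    exists_factorModel (CoeffRingP n d ⧸ 𝔮) (FractionRing (CoeffRingP n d ⧸ 𝔮)) FA hFAhom hFK
  have hdoors : ∀ i : Fin N, ∃ a : CoeffRingP n d ⧸ 𝔮, a ≠ 0 ∧
      ∀ (B : Type) [CommRing B] [IsNoetherianRing B] [Algebra (CoeffRingP n d ⧸ 𝔮) B] [Module.Flat (CoeffRingP n d ⧸ 𝔮) B]
        [Algebra ℤ B] [Algebra.Smooth ℤ B],
        IsUnit (algebraMap (CoeffRingP n d ⧸ 𝔮) B a) →
        ∀ (k : Type) [Field k] (θ : B →+* k) (H : Scheme.{0}) (ι : H ⟶ (Literature.AlgebraicGeometry.Motives.projectiveSpace n k).left),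
          letI := MvPolynomial.gradedAlgebra (σ := Fin (n + 1)) (R := k)
          Set.range ι = {x : Proj (homogeneousSubmodule (Fin (n + 1)) k) |
              MvPolynomial.map (θ.comp (algebraMap (CoeffRingP n d ⧸ 𝔮) B)) (P i) ∈ x.asHomogeneousIdeal} →
          DescDoorAt B k θ n H ι := fun i =>
    exists_forall_descDoorAt_of_primeForm (CoeffRingP n d ⧸ 𝔮) (FractionRing (CoeffRingP n d ⧸ 𝔮)) n hn1 (P i) (hPhom i) (hPprime i)
  choose a ha hdoor using hdoors
  -- the shrink to a smooth `ℤ`-algebra inverting `c` and every `aᵢ`, and the witness `f ∉ 𝔮`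
  set atot : CoeffRingP n d ⧸ 𝔮 := c * ∏ i, a i with hatot_def
  have hatot : atot ≠ 0 := mul_ne_zero hc (Finset.prod_ne_zero_iff.mpr fun i _ => ha i)
  obtain ⟨a₀, ha₀, hsm, hflat, hunit, -⟩ := @exists_smooth_away_away (CoeffRingP n d ⧸ 𝔮) _ _ _ _ (hft' _) atot hatot
  obtain ⟨f, hf𝔮, hfactor⟩ := exists_witness_factor_through_away_away 𝔮 atot hatot a₀ ha₀
  refine ⟨f, hf𝔮, fun 𝔭 _ hle hf𝔭 k _ _ θ hker H ι hcut => ?_⟩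
  obtain ⟨hH, hF0, hrange⟩ := hcut
  letI := MvPolynomial.gradedAlgebra (σ := Fin (n + 1)) (R := k)
  -- the point factors through `B = A[1/atot][1/a₀]`
  obtain ⟨θB, hθB⟩ := hfactor k θ (by rw [hker]; exact hle) (fun h0 => hf𝔭 (by rw [← hker]; exact h0))
  haveI := hflat
  have hsmB : Algebra.Smooth ℤ (Localization.Away a₀) := by
    convert hsm <;> rfl
  set θ' : CoeffRingP n d ⧸ 𝔮 →+* k := θB.comp (algebraMap (CoeffRingP n d ⧸ 𝔮) (Localization.Away a₀)) with hθ'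
  have hθ'mk : θ'.comp (Ideal.Quotient.mk 𝔮) = θ := by
    rw [hθ', IsScalarTower.algebraMap_eq (CoeffRingP n d ⧸ 𝔮) (Localization.Away atot) (Localization.Away a₀)]
    simpa only [RingHom.comp_assoc] using hθB
  have hFθ : univHyp n d θ = MvPolynomial.map θ' FA := hspec k θ θ' hθ'mk
  -- units at the point
  have hunit_c : IsUnit (θ' c) := by
    rw [hθ', RingHom.comp_apply]
    exact ((isUnit_of_dvd_unit (map_dvd _ (dvd_mul_right c _)) hunit)).map θB
  have hunit_a : ∀ i, IsUnit (algebraMap (CoeffRingP n d ⧸ 𝔮) (Localization.Away a₀) (a i)) := fun i =>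
    isUnit_of_dvd_unit (map_dvd _ ((Finset.dvd_prod_of_mem a (Finset.mem_univ i)).mul_left c)) hunit
  -- the fibre reading: `range ι = V₊(F_θ) = ⋃ᵢ V₊(Pᵢ,θ')`, irreducible, hence ONE `V₊(Pᵢ₀,θ')`
  have hunion : Set.range ι = ⋃ i : Fin N, {x : Proj (homogeneousSubmodule (Fin (n + 1)) k) |
      MvPolynomial.map θ' (P i) ∈ x.asHomogeneousIdeal} := by
    rw [hrange, hFθ]
    ext x
    simp only [Set.mem_setOf_eq, Set.mem_iUnion]
    exact hfib k θ' hunit_c x.asHomogeneousIdeal.toIdeal x.isPrime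
  have hirr : IsIrreducible (Set.range ι) := by
    rw [← Set.image_univ]
    exact (IrreducibleSpace.isIrreducible_univ (X := H)).image _ ι.continuous.continuousOn
  obtain ⟨i₀, hi₀⟩ := exists_eq_of_isIrreducible_eq_iUnion hirr _
    (fun i => by
      have hzl : {x : Proj (homogeneousSubmodule (Fin (n + 1)) k) | MvPolynomial.map θ' (P i) ∈ x.asHomogeneousIdeal} =
          ProjectiveSpectrum.zeroLocus (homogeneousSubmodule (Fin (n + 1)) k) {MvPolynomial.map θ' (P i)} := by
        ext y
        change _ ∈ y.asHomogeneousIdeal ↔ ({MvPolynomial.map θ' (P i)} : Set (MvPolynomial (Fin (n + 1)) k)) ⊆ (y.asHomogeneousIdeal : Set _)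
        rw [Set.singleton_subset_iff]
        rfl
      rw [hzl]
      exact ProjectiveSpectrum.isClosed_zeroLocus _ _)
    hunion
  -- door `i₀` and the glue
  have hD : DescDoorAt (Localization.Away a₀) k θB n H ι := hdoor i₀ (Localization.Away a₀) (hunit_a i₀) k θB H ι hi₀
  exact descDoorSharp_of_descDoorAt_int k n H ι (Localization.Away a₀) θB hD

/-! ## The rung -/

/-- ★★★ **RUNG LC — EL♮(n)'s conclusion in LARGE CHARACTERISTIC, degree by degree.**  For every `n, d : ℕ` there is `M = M(n, d)` such that: for every prime
`p > M`, every algebraically closed field `k` of characteristic `p`, every scheme `H` with a morphism `ι : H ⟶ ℙⁿ_k` and every degree-`d` form `F` over `k`,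
if `H` is INTEGRAL, `F ≠ 0` and the range of `ι` is the hypersurface `V₊(F)`, then `ELNatConclusionO k n H ι` — the conclusion of EL♮ (a characteristic-`0`
DVR `O ↠ k`, a tower of blow-ups of `ℙⁿ_O` in regular `O`-flat centres over the non-generic points of `H` meeting the special fibre inside the running strict
transforms, whose end strict transform of `H` is regular).  = ✓ `elnatLargeChar_of_spread` (roof ✓ `largeChar_roof`: Noetherian induction on `Spec ℤ[c]`; engine
✓ `descDoorSharp_elnat`) at ★★ `spread_holds`.  A RUNG in the degree (M ineffective, depends on `d`); NOT EL♮(3), NOT EL♮, closes no registered stub.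
[cite: Grothendieck1966, EGA IV₃ §8–§9] [cite: Kollar2007, Thm. 3.69] [OURS · L1 W4.5b · RUNG LC; EL♮(3) NOT proved; resolution in positive characteristic NOT proved] -/
theorem elnat_largeChar (n d : ℕ) :
    ∃ M : ℕ, ∀ (p : ℕ), p.Prime → ∀ (k : Type) [Field k] [CharP k p] [IsAlgClosed k], M < p →
      ∀ (H : Scheme.{0}) (ι : H ⟶ (Literature.AlgebraicGeometry.Motives.projectiveSpace n k).left)
        (F : MvPolynomial (Fin (n + 1)) k), F.IsHomogeneous d →
        (IsIntegral H ∧ F ≠ 0 ∧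
          letI := MvPolynomial.gradedAlgebra (σ := Fin (n + 1)) (R := k)
          Set.range ι = {x : Proj (homogeneousSubmodule (Fin (n + 1)) k) | F ∈ x.asHomogeneousIdeal}) →
        ELNatConclusionO k n H ι :=
  elnatLargeChar_of_spread n d
    (fun k _ H ι F =>
      IsIntegral H ∧ F ≠ 0 ∧
        letI := MvPolynomial.gradedAlgebra (σ := Fin (n + 1)) (R := k)
        Set.range ι = {x : Proj (homogeneousSubmodule (Fin (n + 1)) k) | F ∈ x.asHomogeneousIdeal})
    (spread_holds n d)

end LargeChar

end Summit.ResolutionOfSingularities.ResolutionOfSingularities.Cruxes.EquisingularLiftNat.Sections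

end
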